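import Mathlib
import Summits.ValiantsHypothesis.ValiantsHypothesis.Theses.UlrichPadded
import Literature.Computability.AlgebraicComplexity.PermanentIrreducible
import Literature.Computability.AlgebraicComplexity.VonZurGathenSingPermHeight

/-!
# IdeatorSketch2 (first-lemma sketch of ideator 2, NOT a skeleton line) — crux-ideate stmt-ValiantsHypothesis-5666 (PermHypersurfaceFactorial), ideator 2

First lemmas of the two idea cards, stated over existing declarations, plus the kernel-checked
Mathlib glue showing that card 1's two lemmas literally imply the crux decl.
-/

noncomputable section

namespace Summit.ValiantsHypothesis.ValiantsHypothesis.Cruxes.PermHypersurfaceFactorial.IdeatorSketch2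

open MvPolynomial Literature.Computability.AlgebraicComplexity

/-- The ring `S_n = ℂ[x_ij] / (per_n)`. -/
abbrev PerRing (n : ℕ) : Type :=
  MvPolynomial (Fin n × Fin n) ℂ ⧸ Ideal.span {perPoly (Fin n) ℂ}

/-- The `(0,0)` permanental minor `∂ per_n / ∂ x₀₀ = per(x(0|0))`, as an element of `ℂ[x]`. -/
def minor00 (n : ℕ) (h : 3 ≤ n) : MvPolynomial (Fin n × Fin n) ℂ :=
  pderiv ((⟨0, by omega⟩ : Fin n), (⟨0, by omega⟩ : Fin n)) (perPoly (Fin n) ℂ)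

/-! ## Card 1 (row-linear symmetric algebra / Nagata at the minor) -/

/-- **H(n)** (card 1, load-bearing lemma, height form à la `vonzurGathen1987_singPerm_height`):
every prime of `ℂ[x_ij]` containing the `n` maximal subpermanents of the rows `≠ 0`
(`= ∂ per_n/∂x_{0j}`, `pderiv_perPoly`) has height `≥ 3` (`n ≥ 3`; false for `det`, where the
maximal minors of an `(n-1) × n` matrix have height `2`, and false in characteristic `2`). -/
def RowPartialsHeightThree : Prop :=
  ∀ n : ℕ, (h : 3 ≤ n) → ∀ P : Ideal (MvPolynomial (Fin n × Fin n) ℂ), P.IsPrime →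
    (∀ j : Fin n, pderiv ((⟨0, by omega⟩ : Fin n), j) (perPoly (Fin n) ℂ) ∈ P) → 3 ≤ P.height

/-- Card 1, lemma A: the image of the minor `per(x(0|0))` is a PRIME ELEMENT of `S_n` (`n ≥ 3`),
i.e. `(per_n, per(x(0|0)))` is a prime ideal of `ℂ[x]` (consequence of `RowPartialsHeightThree`,
unmixedness of the height-2 complete intersection `(P₀, P₁)` and McCoy's lemma). -/
def MinorPrimeModPer : Prop :=
  ∀ n : ℕ, (h : 3 ≤ n) → Prime (Ideal.Quotient.mk (Ideal.span {perPoly (Fin n) ℂ}) (minor00 n h))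

/-- Card 1, lemma B: `S_n[1/per(x(0|0))]` is factorial — it is a localisation of the polynomial
ring in the `n² - 1` variables other than `x₀₀` (solve the row-`0` Laplace expansion
`per_n = x₀₀ · per(x(0|0)) + Q` for `x₀₀`). -/
def AwayMinorUFD : Prop :=
  ∀ n : ℕ, (h : 3 ≤ n) →
    UniqueFactorizationMonoid
      (Localization.Away (Ideal.Quotient.mk (Ideal.span {perPoly (Fin n) ℂ}) (minor00 n h)))

instance (n : ℕ) : IsNoetherianRing (PerRing n) := by
  unfold PerRing; infer_instance

theorem isDomain_perRing (n : ℕ) (h : 3 ≤ n) : IsDomain (PerRing n) := by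
  haveI : Nonempty (Fin n) := ⟨⟨0, by omega⟩⟩
  have hirr : Irreducible (perPoly (Fin n) ℂ) := perPoly_irreducible
  have hprime : Prime (perPoly (Fin n) ℂ) := hirr.prime
  have : (Ideal.span {perPoly (Fin n) ℂ}).IsPrime :=
    (Ideal.span_singleton_prime hprime.ne_zero).mpr hprime
  exact Ideal.Quotient.isDomain _

/-- **Kernel-checked glue for card 1**: Nagata's criterion (Mathlib
`UniqueFactorizationMonoid.iff_localizationAway_of_prime`) and
`UniqueFactorizationMonoid.isPrincipal_of_height_eq_one` turn lemmas A and B into the crux decl. -/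
theorem permHypersurfaceFactorial_of (hA : MinorPrimeModPer) (hB : AwayMinorUFD) :
    Summit.ValiantsHypothesis.ValiantsHypothesis.Theses.UlrichPadded.PermHypersurfaceFactorial := by
  intro n hn P hP h1
  haveI : IsDomain (PerRing n) := isDomain_perRing n hn
  haveI := hP
  have hufd : UniqueFactorizationMonoid (PerRing n) :=
    (UniqueFactorizationMonoid.iff_localizationAway_of_prime (hA n hn)).mpr (hB n hn)
  exact UniqueFactorizationMonoid.isPrincipal_of_height_eq_one h1

/-! ## Card 2 (standing Grothendieck–Samuel line made gap-free: derivation test) -/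

/-- Card 2, the lever in general form: a derivation lowers symbolic order by at most one, so if
some partial `∂f/∂x_i` is NOT in the prime `𝔮 ∋ f`, then `f ∉ 𝔮² R_𝔮` — hence `R_𝔮/(f)` is a
regular local ring (no Jacobian criterion needed). -/
def DerivationSymbolicSquare : Prop :=
  ∀ (σ : Type) (K : Type) [Field K] (f : MvPolynomial σ K) (Q : Ideal (MvPolynomial σ K))
    [Q.IsPrime] (i : σ), pderiv i f ∉ Q → f ∈ Q →
      algebraMap (MvPolynomial σ K) (Localization.AtPrime Q) f ∉
        (IsLocalRing.maximalIdeal (Localization.AtPrime Q)) ^ 2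

/-- Card 2, first lemma in crux form: `S_n` is regular in codimension `≤ 3` (`n ≥ 3`): the input
`hreg` of the PROVED tree theorem
`Grothendieck1968_samuelConjecture_hypersurface.regular_codim_three` at every maximal ideal
(from `DerivationSymbolicSquare` + `vonzurGathen1987_singPerm_height_holds`: a prime of height
`≤ 4` in `ℂ[x]` misses some `∂ per_n/∂x_ij`). -/
def RegularCodimThree : Prop :=
  ∀ n : ℕ, 3 ≤ n → ∀ (P : Ideal (PerRing n)) [P.IsPrime], P.height ≤ 3 →
    IsRegularLocalRing (Localization.AtPrime P)

end Summit.ValiantsHypothesis.ValiantsHypothesis.Cruxes.PermHypersurfaceFactorial.IdeatorSketch2
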